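import Literature.NumberTheory.EllipticCurves.HeathBrown1994.CongruentTwoSelmerOddGraphFamilies
import HarnessLib

/-!
# Iskra's family through Monsky's matrix: `s(p₁⋯p_t) = 0` for primes `≡ 3 (mod 8)` with `(p_j/p_k) = −1` (`j < k`) (§9)

Topic `NumberTheory/EllipticCurves`, namespace `Literature.NumberTheory.EllipticCurves.HeathBrown1994.Families`
(third continuation module of `HeathBrown1994/CongruentTwoSelmerMonskyMatrix.lean`).  Everything PROVED; no
definition, no named fact.

Iskra, Proc. Japan Acad. 72A (1996) 168–169, Theorem (restated verbatim by Rhoades, JNT 129 (2009) §1):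
"`p₁⋯p_ℓ` is non-congruent when `p_j ≡ 3 (mod 8)` for all `j` and `(p_j/p_k) = −1` for all `j < k`."
Through Monsky's matrix (ours, uniformly in `ℓ`): all `pᵢ ≡ 3 (mod 8)` give `D₂ = I`, `D₋₂ = 0`; the tournament
condition and reciprocity for primes `≡ 3 (mod 4)` make `A` LOWER TRIANGULAR (`a_kj = [(p_j/p_k) = −1] = 1` for
`j < k`, `a_jk = [(p_k/p_j) = −1] = 0`); then `M(x, y) = 0` forces `y = (A + I)x` and `(A² + A + I)x = 0`, and
`A² + A + I` is lower triangular with unit diagonal (`d² + d + 1 = 1` in `𝔽₂`), hence invertible: `det M = 1`,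
`s(n) = 0`, and with §6 `BSD(E_n, ℓ)` for every prime `ℓ` modulo the four named facts.

## References

* [Iskra1996] B. Iskra, *Non-congruent numbers with arbitrarily many prime factors congruent to 3 modulo 8*,
  Proc. Japan Acad. Ser. A 72 (1996) 168–169, Theorem.
* [Rhoades2009] R. C. Rhoades, *2-Selmer groups and the Birch–Swinnerton-Dyer conjecture for the congruent number
  curves*, J. Number Theory 129 (2009) 1379–1391, §1 (restatement).
* [HeathBrown1994SelmerCongruentII] Appendix (Monsky), pp. 39–41.
* [IrelandRosen1990] Ch. 5 §2 (Jacobi reciprocity).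
-/

open Matrix Finset Literature.NumberTheory.EllipticCurves Literature.NumberTheory.EllipticCurves.HeathBrown1994

namespace Literature.NumberTheory.EllipticCurves.HeathBrown1994.Families

variable {k : ℕ} (p : Fin k → ℕ)

/-- Under Iskra's hypotheses `A` is lower triangular: `a_jl = 0` for `j < l` (`(p_l/p_j) = +1` by reciprocity
for two primes `≡ 3 (mod 4)` with `(p_j/p_l) = −1`). [cite: IrelandRosen1990, Ch. 5 §2 Thm. 2 (reciprocity)] -/
theorem legendreMatrix_apply_eq_zero_of_lt (hp : ∀ i, (p i).Prime) (h3 : ∀ i, p i % 8 = 3)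
    (hT : ∀ i j, i < j → jacobiSym (p i : ℤ) (p j) = -1) {i j : Fin k} (hij : i < j) :
    legendreMatrix p i j = 0 := by
  rw [legendreMatrix_apply_of_ne p hij.ne]
  -- entry = [(p j / p i) = −1]; reciprocity: (p_j/p_i) = −(p_i/p_j) = 1
  have hrec : jacobiSym (p j : ℤ) (p i) = -jacobiSym (p i : ℤ) (p j) :=
    jacobiSym.quadratic_reciprocity_three_mod_four (by have := h3 j; omega) (by have := h3 i; omega)
  rw [hT i j hij] at hrec
  have _ := hp
  exact addLegendreSym_of_eq_one (by rw [hrec]; norm_num)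

/-- … and `a_jl = 1` for `l < j`. [cite: IrelandRosen1990, Ch. 5 §2 (definition of the Jacobi symbol)] -/
theorem legendreMatrix_apply_eq_one_of_gt (hT : ∀ i j, i < j → jacobiSym (p i : ℤ) (p j) = -1)
    {i j : Fin k} (hij : j < i) : legendreMatrix p i j = 1 := by
  rw [legendreMatrix_apply_of_ne p hij.ne']
  exact addLegendreSym_of_eq_neg_one (hT j i hij)

/-- `A` is lower triangular (block triangular for the dual order). [cite: HeathBrown1994SelmerCongruentII, Appendix (Monsky), typescript p. 39 L10–L13] -/
theorem legendreMatrix_blockTriangular (hp : ∀ i, (p i).Prime) (h3 : ∀ i, p i % 8 = 3)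
    (hT : ∀ i j, i < j → jacobiSym (p i : ℤ) (p j) = -1) :
    (legendreMatrix p).BlockTriangular OrderDual.toDual := by
  intro i j hij
  exact legendreMatrix_apply_eq_zero_of_lt p hp h3 hT (by simpa using hij)

/-- The diagonal of `A² + A + I` is `1`: `(A²)_ii = a_ii²` for a triangular `A`, and `d² + d + 1 = 1` in `𝔽₂`.
[cite: HeathBrown1994SelmerCongruentII, Appendix (Monsky), typescript p. 39 (arithmetic over ℤ/2)] -/
theorem diag_sq_add_self_add_one (hp : ∀ i, (p i).Prime) (h3 : ∀ i, p i % 8 = 3)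
    (hT : ∀ i j, i < j → jacobiSym (p i : ℤ) (p j) = -1) (i : Fin k) :
    (legendreMatrix p * legendreMatrix p + legendreMatrix p + 1) i i = 1 := by
  have hsq : (legendreMatrix p * legendreMatrix p) i i = legendreMatrix p i i * legendreMatrix p i i := by
    rw [Matrix.mul_apply]
    refine Finset.sum_eq_single i (fun j _ hji => ?_) (fun h => absurd (Finset.mem_univ i) h)
    rcases lt_or_gt_of_ne hji with hlt | hgt
    · rw [legendreMatrix_apply_eq_zero_of_lt p hp h3 hT hlt, mul_zero]
    · rw [legendreMatrix_apply_eq_zero_of_lt p hp h3 hT hgt, zero_mul]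
  rw [Matrix.add_apply, Matrix.add_apply, hsq, Matrix.one_apply_eq]
  have key : ∀ d : ZMod 2, d * d + d + 1 = 1 := by decide
  exact key _

/-- `det (A² + A + I) = 1` for Iskra's tournament. [cite: HeathBrown1994SelmerCongruentII, Appendix (Monsky), typescript p. 39 L27–L33 (the matrix; evaluation ours)] -/
theorem det_sq_add_self_add_one (hp : ∀ i, (p i).Prime) (h3 : ∀ i, p i % 8 = 3)
    (hT : ∀ i j, i < j → jacobiSym (p i : ℤ) (p j) = -1) :
    (legendreMatrix p * legendreMatrix p + legendreMatrix p + 1).det = 1 := by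
  have hA := legendreMatrix_blockTriangular p hp h3 hT
  have hB : (legendreMatrix p * legendreMatrix p + legendreMatrix p + 1).BlockTriangular OrderDual.toDual :=
    ((hA.mul hA).add hA).add blockTriangular_one
  rw [Matrix.det_of_lowerTriangular _ hB]
  exact Finset.prod_eq_one fun i _ => diag_sq_add_self_add_one p hp h3 hT i

/-- `D₂ = I`, `D₋₂ = 0` when every prime is `≡ 3 (mod 8)`. [cite: IrelandRosen1990, Ch. 5 §2 Prop. 5.2.2] -/
theorem legendreDiagonal_allThree (h3 : ∀ i, p i % 8 = 3) :
    legendreDiagonal p 2 = 1 ∧ legendreDiagonal p (-2) = 0 := by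
  constructor
  · unfold legendreDiagonal
    rw [← Matrix.diagonal_one]
    congr 1; ext i
    exact addLegendreSym_of_eq_neg_one (jacobiSym_two_eq_neg_one (Or.inl (h3 i)))
  · unfold legendreDiagonal
    rw [← Matrix.diagonal_zero]
    congr 1; ext i
    exact addLegendreSym_of_eq_one (jacobiSym_neg_two_eq_one (Or.inr (h3 i)))

/-- **Iskra's family through Monsky's matrix: `det M = 1`** (so `s(p₁⋯p_k) = 0`) for distinct primes
`pᵢ ≡ 3 (mod 8)` with `(p_i/p_j) = −1` for `i < j`, uniformly in `k`.
[cite: Iskra1996, Theorem (p. 168)] [cite: Rhoades2009, §1 (restatement of Iskra's theorem)] [cite: HeathBrown1994SelmerCongruentII, Appendix (Monsky), typescript p. 39 L27–L33 (the matrix; evaluation ours)] -/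
theorem det_monskyMatrixOdd_eq_one_of_iskra (hp : ∀ i, (p i).Prime) (h3 : ∀ i, p i % 8 = 3)
    (hT : ∀ i j, i < j → jacobiSym (p i : ℤ) (p j) = -1) : (monskyMatrixOdd p).det = 1 := by
  obtain ⟨hD2, hDm2⟩ := legendreDiagonal_allThree p h3
  apply det_eq_one_of_ker_trivial
  intro z hz
  obtain ⟨x, y, rfl⟩ : ∃ x y, z = Sum.elim x y := ⟨z ∘ Sum.inl, z ∘ Sum.inr, (Sum.elim_comp_inl_inr z).symm⟩
  rw [monskyMatrixOdd, hD2, hDm2, add_zero, Matrix.fromBlocks_mulVec] at hz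
  simp only [Sum.elim_comp_inl, Sum.elim_comp_inr, Matrix.one_mulVec] at hz
  have htop : (legendreMatrix p + 1) *ᵥ x + y = 0 := by
    funext i; have := congr_fun hz (Sum.inl i); simpa only [Sum.elim_inl, Pi.zero_apply] using this
  have hbot : x + legendreMatrix p *ᵥ y = 0 := by
    funext i; have := congr_fun hz (Sum.inr i); simpa only [Sum.elim_inr, Pi.zero_apply] using this
  have hy : y = (legendreMatrix p + 1) *ᵥ x := by
    rw [eq_neg_of_add_eq_zero_right htop, neg_eq_self_pi]
  have hx : (legendreMatrix p * legendreMatrix p + legendreMatrix p + 1) *ᵥ x = 0 := by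
    rw [hy, Matrix.mulVec_mulVec, Matrix.mul_add, Matrix.mul_one] at hbot
    rw [Matrix.add_mulVec, Matrix.one_mulVec, add_comm]
    exact hbot
  have hU : IsUnit (legendreMatrix p * legendreMatrix p + legendreMatrix p + 1) :=
    (Matrix.isUnit_iff_isUnit_det _).mpr (by rw [det_sq_add_self_add_one p hp h3 hT]; exact isUnit_one)
  have hx0 : x = 0 := by
    have hinj := Matrix.mulVec_injective_iff_isUnit.mpr hU
    exact hinj (by rw [hx, Matrix.mulVec_zero])
  subst hx0
  rw [Matrix.mulVec_zero] at hy
  subst hy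
  funext i; cases i <;> rfl

/-- **`BSD(E_n, ℓ)` for every prime `ℓ` on Iskra's family** (`n = p₁⋯p_k`, all `pᵢ ≡ 3 (mod 8)`,
`(p_i/p_j) = −1` for `i < j`), modulo Monsky's theorem and BT26 / Deuring–Hecke / BF24 (§6 of the main file).
[cite: Iskra1996, Theorem (p. 168)] [cite: BurungaleTian2026, Thm. 1.1 with Cor. 1.4] [cite: BurungaleFlach2024, Cor. 2] -/
theorem forall_bsdp_of_iskra (hM : monsky_card_selmerGroup_two_odd)
    (hBT : burungaleTian_analyticRank_eq_zero_of_selmerCorank_eq_zero_of_hasCM)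
    (hH : hasEntireLFunction_of_j_mem_maximalCMJInvariants)
    (hBF : bsdTriple_of_hasCM_of_L_one_ne_zero) (hp : ∀ i, (p i).Prime) (hinj : Function.Injective p)
    (h3 : ∀ i, p i % 8 = 3) (hT : ∀ i j, i < j → jacobiSym (p i : ℤ) (p j) = -1) (ℓ : ℕ) (hℓ : ℓ.Prime) :
    haveI := isElliptic_congruentNumberCurve (n := ∏ i, p i)
      (Finset.prod_ne_zero_iff.mpr fun i _ => (hp i).ne_zero)
    haveI := isGloballyMinimal_congruentNumberCurve (n := ∏ i, p i) (squarefree_prod_of_injective p hp hinj)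
    BSDp (congruentNumberCurve (∏ i, p i)) ℓ :=
  forall_bsdp_of_monsky_of_BT_BF_odd p hM hBT hH hBF hp
    (fun i => Nat.odd_iff.mpr (by have := h3 i; omega)) hinj
    (det_monskyMatrixOdd_eq_one_of_iskra p hp h3 hT) ℓ hℓ

end Literature.NumberTheory.EllipticCurves.HeathBrown1994.Families
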